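import Summits.BirchSwinnertonDyer.BirchSwinnertonDyer.Theorems.ByReductionTypeAtTwoAdditiveReducibleSplitTwistKatoMemberDoors
import HarnessLib

/-!
# Crux `AdditiveRankZeroAtTwo` (K4 item 19098): the crux BY NAME from its one-sided residual, v11 — NO over-`K` object,
# NO Milne, NO Hoffstein–Luo, NO sibling crux `MultiplicativeRankZeroAtTwo`: the additive block's Kato side is
# {2 readings, 4 block targets, (A) on the `S₃`-image curves} and its research residual over `ℚ` is {(A) there, the LOWER half}
# (seat `bsd-2adic-k4-w3` GEN 0; sequel of k4-w2 GEN 4's v9 (p674625) and addL2x GEN 16's v10 (v9 with T19 split into its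
# (−1)/(−2)-blocks); the new inputs are the reducible split-twist block targets `KatoMemberSharpAtTwoAdditiveNeg{One,Two}SplitTwistReducible`)

Cell `bsd-2adic`, rung K4, crux stmt-BirchSwinnertonDyer-19098, split v2.2 (children C1″ 22615, C2″ 22616, C3″ 22617, C4″ 22618,
C5‴ 22619, glue 22620). `--supports` helper of the GLUE item 22620 («children ⟹ parent»). HONEST FRAMING (D-0036/D-0054): an
assembly-shaped CONDITIONAL theorem; every research-grade input is displayed; closes nothing at the `∀`-level; nothing booked;
BSD is not proved by any of this. NO restate of the executed split is asked (record for the planner; D-0152).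

WHAT v11 CHANGES (versus v10 = `additiveRankZeroAtTwo_of_residual_v10`, addL2x GEN 16, whose binders are v9's VERBATIM except that
`hX` became the two blocks `h₁`, `h₂`). (1) The over-`K` binder `hQKm9` (= child C4″
restricted to the reducible split-twist pot-mult curves) DISAPPEARS: on that habitat the upper half is
`addPotMultSplitTwist_reducibleUpper_two_of_targets` (block targets `hR₁`, `hR₂` of `…ReducibleSplitTwistKatoMemberDefs.lean` —
Kato's member package with Conj. 12.10 at the exceptional prime of (12.5.1), DERIVED by the transport T20/R14 modulo the
odd-branch package — + Cassels + GZK + modularity), and the lower half joins the displayed lower-half binder. With `hQKm9` go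
the PRINT binders `hMilneC` (Milne 1972), `hHL` (Hoffstein–Luo — a `cite_only` head of the route) and the SIBLING CRUX `hMult`
(`MultiplicativeRankZeroAtTwo`, item 19096): the additive crux no longer leans on the multiplicative one. (2) The blocks `h₁`, `h₂`
are consumed as in v10 (`katoSharpAtTwoAdditive_of_reading_of_negOne_of_negTwo`). (3) The three lower-half binders of v9/v10 on the
pot-mult block (`hLowMI`, `hLowMred9`, and the lower half hidden inside `hQKm9`) MERGE into ONE:
`hLowM` = the lower half over `ℚ` on the whole potentially multiplicative block (a genuine part of the crux,
`hLowM_of_additiveRankZeroAtTwo`).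

Inputs of `additiveRankZeroAtTwo_of_residual_v11`: PRINT {`hGZK`, `hmod`, `hmodN`, `hLim2`, `hFW`, `hCassels`, `hCT` (the last
now KERNEL-fed: `WeierstrassCurve.exists_casselsTate_pairing_holds`, not imported here to keep the cones apart)} + READINGS
{`hNST2` (D-audit PASS), `hinS` (hMHnst@2 + R12♯, AS-PRINTED)} + TARGETS {`h₁`, `h₂` (irreducible (−1)/(−2)-blocks, GEN 16),
`hR₁`, `hR₂` (reducible (−1)/(−2)-blocks, this seat)} + research `∀`-objects {C1″ `hAna`, C3″ `hLow` (VERBATIM children),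
(I1M′) `hAnaMI`, (I3M) `hLowM`}. So on the whole ADDITIVE block the residual reads
**{(A) on the `S₃`-image curves (C1″ ∪ I1M′), the LOWER half over `ℚ` (C3″ ∪ I3M)} modulo {2 readings, 4 block targets, PRINT}**
— one-sided, Kato-uniform, sibling-free. §2 records that every v11 binder is implied by the crux or by v9/v10's binders + the two
new targets (no hidden strengthening).

References: [Kato2004Asterisque] Thm. 12.5 (3)(4), (12.5.1) (p. 222), Thm. 12.6 (p. 222), Conj. 12.10 (p. 224), 13.13, §14.8,
§14.14, Prop. 14.16 (2) and its proof (pp. 238–245), §17.13 (p. 280); [GreenbergLNM1716] Thm. 1.14; [MazurTateTeitelbaum1986Invent]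
§I.17; [MazurRubin2004] Thm. 2.3.4; [SilvermanATAEC1994] V.5.3, Ex. 5.11; [CoatesSujatha2005] statement (A); [Lim2017FineSelmer]
Thm. 3.5; [FerreroWashington1979]; [Cassels1965ArithmeticVIII]; [SilvermanAEC2009] X.4.14; [Miller2011LMS] Def. 1.1.
-/

set_option autoImplicit false
set_option linter.dupNamespace false

noncomputable section

open scoped Classical

namespace Summit.BirchSwinnertonDyer.BirchSwinnertonDyer.Theorems.AddKatoTwo

open WeierstrassCurve Literature.NumberTheory.EllipticCurves
  Literature.NumberTheory.EllipticCurves.ModularForms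
  Literature.NumberTheory.EllipticCurves.Kato2004
  Literature.NumberTheory.EllipticCurves.Rank1Residual
  Literature.NumberTheory.EllipticCurves.Rank1Residual.Typed
  Literature.NumberTheory.IwasawaTheory
  Summit.BirchSwinnertonDyer.Rank1Residual Summit.BirchSwinnertonDyer.Rank1Residual.AdditivePotMult
  Summit.BirchSwinnertonDyer.Rank1Residual.X5.AddTwoL2
  Summit.BirchSwinnertonDyer.BirchSwinnertonDyer.Theses.ByReductionTypeAtTwo
  Summit.BirchSwinnertonDyer.BirchSwinnertonDyer.Theorems.SemistableKatoTwo

/-! ## §1 The crux BY NAME, ONE-SIDED, SIBLING-FREE (glue v11) -/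

/-- **The crux `AdditiveRankZeroAtTwo` (item stmt-BirchSwinnertonDyer-19098; type = the route decl verbatim) from its ONE-SIDED,
SIBLING-FREE residual, v11.** Inputs: PRINT {`hGZK`, `hmod`, `hmodN`, `hLim2`, `hFW`, `hCassels`, `hCT`} + READINGS {`hNST2`,
`hinS`} + TARGETS {`h₁`, `h₂` = `KatoSharpAtTwoAdditiveNeg{One,Two}SplitTwist` (irreducible blocks), `hR₁`, `hR₂` =
`KatoMemberSharpAtTwoAdditiveNeg{One,Two}SplitTwistReducible` (reducible blocks)} + research `∀`-objects: C1″ `hAna`, C3″ `hLow`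
(VERBATIM children), (I1M′) `hAnaMI` = (A) on the irreducible non-abelian-`ℚ(E[2])` pot-mult curves, (I3M) `hLowM` = the lower
half over `ℚ` on the whole pot-mult block. NO binder for C2″, NO over-`K` binder (C4″), NO Milne, NO Hoffstein–Luo, NO sibling
`MultiplicativeRankZeroAtTwo`. Branches: `0 ≤ ord₂ j` → the potentially-good door `addPotGood_bsdp_two_of_kato_of_lower` with its
member inputs SUPPLIED from `hinS` (as in v9/v10); `ord₂ j < 0` → upper by `addPotMult_upper_two_of_readings_of_targets`, lower by
`hLowM`, `bsdp_of_missingPPartAt`. Conditional (audit `proof.conditional`); the item is NOT closed.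
[cite: Kato2004Asterisque, Thm. 12.5 (3) and (12.5.1) (p. 222), Conj. 12.10 (p. 224), 13.13 (p. 233), Thm. 12.6 (p. 222), §14.8 (p. 238), §14.14 (p. 243), Prop. 14.16 (2) and its proof (pp. 244–245), §17.13 (p. 280)]
[cite: GreenbergLNM1716, Thm. 1.14 (p. 68)] [cite: MazurTateTeitelbaum1986Invent, §I.17] [cite: MazurRubin2004, Thm. 2.3.4]
[cite: SilvermanATAEC1994, Thm. V.5.3 and Exercise 5.11] [cite: CoatesSujatha2005, statement (A)] [cite: Lim2017FineSelmer, §3 Thm. 3.5]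
[cite: Cassels1965ArithmeticVIII] [cite: SilvermanAEC2009, Thm. X.4.14] [cite: Miller2011LMS, Def. 1.1] -/
theorem additiveRankZeroAtTwo_of_residual_v11
    (hGZK : rank_eq_analyticRank_of_analyticRank_le_one) (hmod : hasEntireLFunction_rat) (hmodN : exists_isNewformOf)
    (hLim2 : Lim2017.thm35_at_two_fineSelmerDual_moduleFinite_of_classicalMuVanishes_of_le_divisionField_four)
    (hFW : ferreroWashington1979_classicalMuVanishes)
    (hCassels : bsdRHS_eq_of_isIsogenous) (hCT : exists_casselsTate_pairing (K := ℚ))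
    (hNST2 : Kato2004.rankZero_padicValNat_sha_add_padicValNat_tamagawa_le_at_two_of_noSplitTwistNegOneNegTwo_of_irreducible_of_fineSelmerDual_fg)
    (hinS : Kato2004.exists_memberHullInputs_two_sharp_of_noSplitTwistNegOneNegTwo)
    (h₁ : KatoSharpAtTwoAdditiveNegOneSplitTwist) (h₂ : KatoSharpAtTwoAdditiveNegTwoSplitTwist)
    (hR₁ : KatoMemberSharpAtTwoAdditiveNegOneSplitTwistReducible)
    (hR₂ : KatoMemberSharpAtTwoAdditiveNegTwoSplitTwistReducible)
    (hAna : ∀ (W : WeierstrassCurve ℚ) [W.IsElliptic] [W.IsGloballyMinimal], ¬ W.HasCM → W.analyticRank = 0 →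
      Addv W 2 → 0 ≤ padicValRat 2 W.j → ¬ IsAbelianGalois ℚ (W.divisionField 2) →
      ∀ (κ : ZpExtension ℚ 2), κ.IsCyclotomic →
        ∃ (γ : Field.absoluteGaloisGroup ℚ) (D : W.FineSelmerDualData κ γ),
          Module.Finite ℤ_[2] (RestrictScalars ℤ_[2] (IwasawaAlgebra 2) D.X))
    (hLow : ∀ (W : WeierstrassCurve ℚ) [W.IsElliptic] [W.IsGloballyMinimal], ¬ W.HasCM → W.analyticRank = 0 →
      Addv W 2 → 0 ≤ padicValRat 2 W.j → MissingLowerBoundAt W 2)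
    (hAnaMI : ∀ (W : WeierstrassCurve ℚ) [W.IsElliptic] [W.IsGloballyMinimal], ¬ W.HasCM → W.analyticRank = 0 →
      Addv W 2 → padicValRat 2 W.j < 0 → W.HasIrreducibleModPGaloisRep 2 → ¬ IsAbelianGalois ℚ (W.divisionField 2) →
      ∀ (κ : ZpExtension ℚ 2), κ.IsCyclotomic →
        ∃ (γ : Field.absoluteGaloisGroup ℚ) (D : W.FineSelmerDualData κ γ),
          Module.Finite ℤ_[2] (RestrictScalars ℤ_[2] (IwasawaAlgebra 2) D.X))
    (hLowM : ∀ (W : WeierstrassCurve ℚ) [W.IsElliptic] [W.IsGloballyMinimal], ¬ W.HasCM → W.analyticRank = 0 →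
      Addv W 2 → padicValRat 2 W.j < 0 → MissingLowerBoundAt W 2) :
    Summit.BirchSwinnertonDyer.BirchSwinnertonDyer.Theses.ByReductionTypeAtTwo.AdditiveRankZeroAtTwo := by
  unfold Summit.BirchSwinnertonDyer.BirchSwinnertonDyer.Theses.ByReductionTypeAtTwo.AdditiveRankZeroAtTwo
  intro W _ _ hcm hr hadd
  haveI : Fact (Nat.Prime 2) := ⟨Nat.prime_two⟩
  by_cases hj : 0 ≤ padicValRat 2 W.j
  · -- potentially good: v4's door with its member inputs SUPPLIED by the (NST′)-sharp member reading (exactly as in v9/v10)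
    have hinPG : Kato2004.exists_memberHullInputs_two_sharp := exists_memberHullInputs_two_sharp_of_noSplitTwistSharp hinS
    have hin : Kato2004.exists_memberHullInputs_two := exists_memberHullInputs_two_of_sharp hinPG
    exact addPotGood_bsdp_two_of_kato_of_lower hGZK hmod hmodN hLim2 hFW hCassels hCT
      (katoAtTwoSharp_of_katoAtTwoNST' hNST2) hin hAna
      (fun W _ _ hcm hr hadd hj hirr _ =>
        additivePotGoodReducibleUpperAtTwo_of_sharpMember hmodN hmod hinPG hLim2 hFW hCassels hGZK W hcm hr hadd hj hirr)
      hLow W hcm hr hadd hj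
  · -- potentially multiplicative: the Kato half from readings + 4 block targets (+ (A) on the S₃-image), the lower half displayed
    have hj' : padicValRat 2 W.j < 0 := lt_of_not_ge hj
    have hr1 : W.analyticRank ≤ 1 := by rw [hr]; exact zero_le_one
    exact bsdp_of_missingPPartAt W 2 hGZK hr1
      (missingPPartAt_of_lower_of_upper W 2 (hLowM W hcm hr hadd hj')
        (addPotMult_upper_two_of_readings_of_targets hGZK hmod hmodN hLim2 hFW hCassels hNST2 hinS h₁ h₂ hR₁ hR₂ hAnaMI
          W hcm hr hadd hj'))

/-! ## §2 No hidden strengthening: the v11 binders from the crux / from v9's (= v10's) binders -/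

/-- **`hLowM` is a genuine PART of the crux**: `AdditiveRankZeroAtTwo` gives `BSD₂(W)` on the pot-mult block, hence the lower
half there (`missingPPartAt_of_bsdp`; `Ш` finite by GZK). Bookkeeping. [cite: Miller2011LMS, §1 and Def. 1.1] -/
theorem hLowM_of_additiveRankZeroAtTwo (hGZK : rank_eq_analyticRank_of_analyticRank_le_one)
    (h : Summit.BirchSwinnertonDyer.BirchSwinnertonDyer.Theses.ByReductionTypeAtTwo.AdditiveRankZeroAtTwo) :
    ∀ (W : WeierstrassCurve ℚ) [W.IsElliptic] [W.IsGloballyMinimal], ¬ W.HasCM → W.analyticRank = 0 →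
      Addv W 2 → padicValRat 2 W.j < 0 → MissingLowerBoundAt W 2 := by
  intro W _ _ hcm hr hadd _
  haveI : Fact (Nat.Prime 2) := ⟨Nat.prime_two⟩
  have hr1 : W.analyticRank ≤ 1 := by rw [hr]; exact zero_le_one
  haveI : Finite W.sha := (hGZK W hr1).2
  exact (lower_and_upper_of_missingPPartAt W 2 (missingPPartAt_of_bsdp W 2 (h W hcm hr hadd))).1

/-- **`hLowM` from v9's (= v10's) three pot-mult lower-half sources** — the irreducible one (`hLowMI`), the reducible (NST′) one
(`hLowMred9`), and child C4″ on the reducible split-twist curves (`hQKm9`, which carries BOTH halves there: Price,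
`addPotMult_bsdp_two_of_mult_of_overKC_at` + `missingPPartAt_of_bsdp`) — granted the PRINT/sibling names v9 used to consume `hQKm9`
(GZK, modularity, Milne any-model, Hoffstein–Luo, `MultiplicativeRankZeroAtTwo`). So v11 asks NOTHING beyond v10 except the two
reducible block targets `hR₁`, `hR₂`, and asks LESS (no over-`K` statement, three PRINT/sibling names fewer). Bookkeeping.
[cite: Milne1972ArithmeticAV, §1 Thm. 1] [cite: HoffsteinLuo1997, Theorem] [cite: Miller2011LMS, §1 and Def. 1.1] -/
theorem hLowM_of_v10_binders (hGZK : rank_eq_analyticRank_of_analyticRank_le_one) (hmod : hasEntireLFunction_rat)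
    (hMilneC : Milne1972.bsdQuotient_baseChange_quadratic_anyModel) (hHL : HoffsteinLuo1997_exists_twist_L_one_ne_zero)
    (hMult : MultiplicativeRankZeroAtTwo)
    (hLowMI : ∀ (W : WeierstrassCurve ℚ) [W.IsElliptic] [W.IsGloballyMinimal], ¬ W.HasCM → W.analyticRank = 0 →
      Addv W 2 → padicValRat 2 W.j < 0 → W.HasIrreducibleModPGaloisRep 2 → MissingLowerBoundAt W 2)
    (hLowMred9 : ∀ (W : WeierstrassCurve ℚ) [W.IsElliptic] [W.IsGloballyMinimal], ¬ W.HasCM → W.analyticRank = 0 →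
      Addv W 2 → padicValRat 2 W.j < 0 →
      (∀ d : ℚ, d = -1 ∨ d = -2 → ¬ (W.quadraticTwist d).HasSplitMultiplicativeReductionAtPrime 2) →
      ¬ W.HasIrreducibleModPGaloisRep 2 → MissingLowerBoundAt W 2)
    (hQKm9 : ∀ (W : WeierstrassCurve ℚ) [W.IsElliptic] [W.IsGloballyMinimal], ¬ W.HasCM → W.analyticRank = 0 →
      Addv W 2 → padicValRat 2 W.j < 0 → ¬ W.HasIrreducibleModPGaloisRep 2 →
      ¬ (∀ d : ℚ, d = -1 ∨ d = -2 → ¬ (W.quadraticTwist d).HasSplitMultiplicativeReductionAtPrime 2) →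
      ∀ (K : Type) [Field K] [NumberField K], Module.finrank ℚ K = 2 →
        SemistableTwistAtTwo W K → (W.quadraticTwist (NumberField.discr K : ℚ)).entireLFunction 1 ≠ 0 →
          MissingPPartOverCAt (W.baseChange K) 2) :
    ∀ (W : WeierstrassCurve ℚ) [W.IsElliptic] [W.IsGloballyMinimal], ¬ W.HasCM → W.analyticRank = 0 →
      Addv W 2 → padicValRat 2 W.j < 0 → MissingLowerBoundAt W 2 := by
  intro W _ _ hcm hr hadd hj
  haveI : Fact (Nat.Prime 2) := ⟨Nat.prime_two⟩
  by_cases hirr : W.HasIrreducibleModPGaloisRep 2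
  · exact hLowMI W hcm hr hadd hj hirr
  · by_cases hnst : ∀ d : ℚ, d = -1 ∨ d = -2 → ¬ (W.quadraticTwist d).HasSplitMultiplicativeReductionAtPrime 2
    · exact hLowMred9 W hcm hr hadd hj hnst hirr
    · have hr1 : W.analyticRank ≤ 1 := by rw [hr]; exact zero_le_one
      haveI : Finite W.sha := (hGZK W hr1).2
      exact (lower_and_upper_of_missingPPartAt W 2 (missingPPartAt_of_bsdp W 2
        (addPotMult_bsdp_two_of_mult_of_overKC_at hGZK hmod hMilneC hHL hMult W hcm hr hadd hj
          (hQKm9 W hcm hr hadd hj hirr hnst)))).1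

/-- **The glue item's shape, v11**: the executed children C1″ (`FineSelmerConjAAtTwoAdditivePotGood`), C3″
(`AdditivePotGoodLowerHalfAtTwo`) BY NAME supply `hAna`/`hLow` verbatim; recorded so the planner sees which route decls v10
consumes (C2″ and C4″ are NOT consumed; C4″'s place is taken by {`h₁`, `h₂`, `hR₁`, `hR₂`, `hAnaMI`, `hLowM`}). Pure logic.
[cite: CoatesSujatha2005, statement (A)] [cite: Miller2011LMS, Def. 1.1] -/
theorem additiveRankZeroAtTwo_of_children_v11
    (hGZK : rank_eq_analyticRank_of_analyticRank_le_one) (hmod : hasEntireLFunction_rat) (hmodN : exists_isNewformOf)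
    (hLim2 : Lim2017.thm35_at_two_fineSelmerDual_moduleFinite_of_classicalMuVanishes_of_le_divisionField_four)
    (hFW : ferreroWashington1979_classicalMuVanishes)
    (hCassels : bsdRHS_eq_of_isIsogenous) (hCT : exists_casselsTate_pairing (K := ℚ))
    (hNST2 : Kato2004.rankZero_padicValNat_sha_add_padicValNat_tamagawa_le_at_two_of_noSplitTwistNegOneNegTwo_of_irreducible_of_fineSelmerDual_fg)
    (hinS : Kato2004.exists_memberHullInputs_two_sharp_of_noSplitTwistNegOneNegTwo)
    (h₁ : KatoSharpAtTwoAdditiveNegOneSplitTwist) (h₂ : KatoSharpAtTwoAdditiveNegTwoSplitTwist)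
    (hR₁ : KatoMemberSharpAtTwoAdditiveNegOneSplitTwistReducible)
    (hR₂ : KatoMemberSharpAtTwoAdditiveNegTwoSplitTwistReducible)
    (hC1 : FineSelmerConjAAtTwoAdditivePotGood) (hC3 : AdditivePotGoodLowerHalfAtTwo)
    (hAnaMI : ∀ (W : WeierstrassCurve ℚ) [W.IsElliptic] [W.IsGloballyMinimal], ¬ W.HasCM → W.analyticRank = 0 →
      Addv W 2 → padicValRat 2 W.j < 0 → W.HasIrreducibleModPGaloisRep 2 → ¬ IsAbelianGalois ℚ (W.divisionField 2) →
      ∀ (κ : ZpExtension ℚ 2), κ.IsCyclotomic →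
        ∃ (γ : Field.absoluteGaloisGroup ℚ) (D : W.FineSelmerDualData κ γ),
          Module.Finite ℤ_[2] (RestrictScalars ℤ_[2] (IwasawaAlgebra 2) D.X))
    (hLowM : ∀ (W : WeierstrassCurve ℚ) [W.IsElliptic] [W.IsGloballyMinimal], ¬ W.HasCM → W.analyticRank = 0 →
      Addv W 2 → padicValRat 2 W.j < 0 → MissingLowerBoundAt W 2) :
    Summit.BirchSwinnertonDyer.BirchSwinnertonDyer.Theses.ByReductionTypeAtTwo.AdditiveRankZeroAtTwo :=
  additiveRankZeroAtTwo_of_residual_v11 hGZK hmod hmodN hLim2 hFW hCassels hCT hNST2 hinS h₁ h₂ hR₁ hR₂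
    (fun W _ _ hcm hr hadd hj hab => hC1 W hcm hr hadd hj hab) (fun W _ _ hcm hr hadd hj => hC3 W hcm hr hadd hj)
    hAnaMI hLowM

end Summit.BirchSwinnertonDyer.BirchSwinnertonDyer.Theorems.AddKatoTwo

end
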